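import Summits.HodgeConjecture.HodgeConjecture.Theorems.HodgeSimilitudeAlgebraic.Negative.FalseWithoutHtype
import Summits.HodgeConjecture.HodgeConjecture.Theorems.HodgeSimilitudeAlgebraic.Negative.NoAntisimilitude
import Summits.HodgeConjecture.HodgeConjecture.Theorems.NikulinTwinTransportTwinSimilitudeAlgebraicLattice
import Summits.HodgeConjecture.HodgeConjecture.Theorems.NikulinTwinTransportTwinSimilitudeAlgebraicTransfer
import Summits.HodgeConjecture.HodgeConjecture.Theorems.NikulinTwinTransportTwinSimilitudeAlgebraic
import Summits.HodgeConjecture.HodgeConjecture.Theorems.NikulinSerreCarrier.Negative.OrientationTwist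
import Literature.AlgebraicGeometry.HodgeTheory.SupportedClassesRational
import Literature.AlgebraicGeometry.HodgeTheory.HardLefschetzThreefold

/-!
# Disproof of `TwinSimilitudeAlgebraic` (crux stmt-HodgeConjecture-13674, X = Sim₂(K3)) — standing adversary, v2

**Findings (index).** NO KILL. The crux X — "for projective K3 surfaces `S, S′` (the tree's
`IsK3Surface`, unfolded), integral generators `p, p′` of `H⁴`, every `ℂ`-linear
`ψ : H²(S′(ℂ);ℂ) → H²(S(ℂ);ℂ)` that is rational (`hrat`), type-preserving (`htype`) and a
`2`-similitude (`hsim`: `(x.y) = a·p′ ⟹ (ψx.ψy) = 2a·p`) is `x ↦ fst_*(snd^* x ∪ γ)` for some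
`γ ∈ algebraicClasses (S ⊗ S′) 2 = N²H⁴((S × S′)(ℂ); ℂ)`" — is the multiplier-2 slice
`SimAlgAt[2]` of the sibling crux `HodgeSimilitudeAlgebraic` (landed `simAlgAt_two_iff`) and an
instance of the Hodge conjecture for the fourfold `S × S′` (the Künneth class of `ψ` is a rational
`(2,2)`-class), rendered on REAL carriers (singular cochains of `X(ℂ)` with the analytic topology,
Hodge models = analytification + natural de Rham comparison + Hodge decomposition, coniveau `N²`).
`¬X` is a non-algebraic rational Hodge class on a product of two projective K3 surfaces, i.e. a
counterexample to HC; none is known, and the tree constructs no K3 surface, so no formal junk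
refutation is available either. What this file CERTIFIES (axioms ⊆ {propext, Classical.choice,
Quot.sound}; `lean check` rc 0, 0 sorries):

* §1 NORMAL FORMS (cited landed theorems + two one-liners): `X ↔ SimAlgAt[2]`
  (`crux_iff_simAlgAt_two`), `X ↔ SimAlgAt[−2]` (`crux_iff_simAlgAt_neg_two`, via the sibling's
  `simAlgAt_neg_iff`: the `∀ p p′` quantifier of X already contains the generator flip, so "the
  sign of the multiplier" is not a degree of freedom); `HodgeSimilitudeAlgebraic → X`
  (`twinSimilitudeAlgebraic_of_hodgeSimilitudeAlgebraic`, landed); and, modulo Buskin + three K3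
  facts + composition of correspondences, `X ↔` "ONE rational lattice `2`-similitude `M` is
  algebraic on every `M`-twin pair of marked projective K3 surfaces"
  (`twinSimilitudeAlgebraic_of_twinTransport` / `twinTransport_of_twinSimilitudeAlgebraic`, landed
  Transfer file). CONSEQUENCE FOR DISPROVERS: to kill X it suffices to exhibit ONE twin pair on which
  the graph of `AA = (sum/diff on E₈(−1)², diag(1,2) on U³)` is not algebraic — equivalent to ¬HC.
* §2 THE SIGN BRANCHES ARE VACUOUS (cited): relative to marking generators a rational `ψ` never
  satisfies `hsim` with multiplier `−2` (`signBranch_vacuous`, = the sibling's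
  `no_antisimilitude_of_markings` at `c = −2`, from `22 < 19 + 19`); so the branches
  `(p, p′) = (∓p₀, ±p₀′)` of X's `∀ p p′` carry no content.
* §3 NEW — `htype` IS LOAD-BEARING AT MULTIPLIER 2 (`twinSimilitudeAlgebraic_false_without_htype`,
  modulo the five named facts of the sibling's multiplier-1 lemma + an orientation family with PD):
  on the marked projective K3 `(S, φ)` with CM period `x₀ = (e₁+f₁) + i(e₂+f₂)`, X-without-`htype`
  would force EVERY endomorphism of `Λ_ℂ` defined over `ℚ` that doubles the K3 form to preserve the
  period line `ℂx₀` (its conjugate `φ⁻¹ρφ` is a rational `2`-similitude, hence algebraic, hence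
  `(2,0)`-preserving by Gysin/cup/pull-back type calculus and `N²H⁴ ⊆ H^{2,2}`); applied to the
  explicit rational lattice `2`-similitude `M` (`exists_twoSimilitude_k3Lattice`) and to `M ∘ s_w`,
  the rational inverse `N` gives `s_w x₀ ∈ ℂ x₀`, contradicting `reflection_x₀P_ne_smul`. To be
  LANDED as `Theorems/TwinSimilitudeAlgebraic/Negative/FalseWithoutHtype.lean`.
* §3b NEW (v2) — `hrat` IS LOAD-BEARING TOO (`twinSimilitudeAlgebraic_false_without_hrat`, Lean,
  modulo seven named facts: the five above + `Huybrechts_K3_hodgeTypes_H2` +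
  `span_isRationalClass_eq_top_of_isSmoothProjective`): at the EXPLICIT NON-CM projective period
  `x₁ = (e₁+f₁) + i(√2(e₂+f₂) + (e₂−f₂))` (`ρ = 19`, `T ≅ ⟨2⟩ ⊕ U` of odd rank 3) and its twin
  `N x₁`, the twisted similitude `ψ = φ⁻¹ R M φ′` (`R = 2 | ½ | 1` on `ℂx₁ | ℂx̄₁ | ⊥`, a non-real
  isometry) preserves every Hodge type (`isOfHodgeType_markingConj_of_star`) and doubles cup
  products, yet is NOT `[γ]_*` for any algebraic `γ` at `μ = ratFamily`: algebraic classes are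
  `ℂ`-combinations of RATIONAL ones (`hspan`), each acting rationally (`isRationalClass_complexGysin_
  ratFamily`) and `(2,0)`-preservingly, hence — KEY LEMMA `ratEnd_aV_of_eigen`, `End_Hdg(T) = ℚ` at
  `x₁` from `√2 ∉ ℚ` — mapping `φ′⁻¹N(e₁+f₁)` into `ℂ φ⁻¹(e₁+f₁)`, while `(R(e₁+f₁))_{e₂} = ¾(√2+1)i`.
  This CORRECTS the sibling's §4 ("`hrat` only generically, needs a transcendence input"): odd
  rank `T` kills CM and a quadratic irrationality suffices. To be LANDED as
  `Theorems/TwinSimilitudeAlgebraic/Negative/FalseWithoutHrat.lean`.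
* §4 NEW — NON-VACUITY OF X MODULO THE K3 FACTS (`hypotheses_inhabited`): granted the period fact and
  the Hodge-type fact `Huybrechts_K3_hodgeTypes_H2`, X's full hypothesis list (both generator
  clauses, `hrat`, `htype`, `hsim`) is met by an INJECTIVE `ψ` between two (a priori different)
  projective K3 surfaces: the twin pair `(S, S′)` with periods `x₀`, `N x₀` (`periodPt_twin`) and
  `ψ = φ⁻¹ ∘ M ∘ φ′`. So X is not vacuous for the right reason, and any proof must produce a genuine
  algebraic class on `S × S′` for this `ψ` (the route: transport of `2·graph` from the Nikulin anchor).
* §5 LOAD-BEARING TABLE / JUNK AUDIT / STRENGTHENINGS / WHY IT RESISTS / NEXT REGIMES (docstrings).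

LANDING (negative lane, `--supports` this item; namespace `…Theorems.TwinSimilitudeAlgebraic.Negative`):
`Negative/FalseWithoutHtype.lean` (p82443, ACCEPTED a5cb05c21ac7: §3 generalised to any multiplier
`c` with a lattice `c`-similitude — reusable by the sibling crux 13676), `Negative/NonCMPeriod.lean`
(p83096, ACCEPTED 6ad6eef97fec: §3b period `x₁`, twist `R`, KEY LEMMA), `Negative/HypothesesInhabited.lean`
(p82810, ACCEPTED 1046393738a0: §4), `Negative/FalseWithoutHrat.lean` (§3b main theorem; proposed after
NonCMPeriod). p82758 (NonCMPeriod v1 with a `def`) is superseded by p83096.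

Targets: payload `targets` / `stuck_stubs` empty (X closes through the landed glue
`twinSimilitudeAlgebraic_of_anchor` from `HodgeIsometryAlgebraic` + `TwinTwistorTransport`; no
skeleton is registered for X itself). Nothing here proves or refutes the crux.
-/

noncomputable section

set_option linter.dupNamespace false

open CategoryTheory MonoidalCategory
open scoped Manifold Matrix ComplexConjugate
open Literature.AlgebraicGeometry.Motives Literature.AlgebraicGeometry.HodgeTheory
open Literature.AlgebraicGeometry.Surfaces Literature.Geometry.Kaehler
open Literature.AlgebraicTopology.SingularHomology
open Literature.NumberTheory.Transcendental (exists_deRhamIsoFamily)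
open Literature.LinearAlgebra.QuadraticForm
open Summit.HodgeConjecture.HodgeConjecture.Theses.NikulinTwinTransport
open Summit.HodgeConjecture.HodgeConjecture.Theorems.NikulinTwinTransport
open Summit.HodgeConjecture.HodgeConjecture.Theorems.HodgeSimilitudeAlgebraic.Negative
open Summit.HodgeConjecture.HodgeConjecture.Theorems.NikulinSerreCarrier.Negative.OrientationTwist
  (ratFamily isRationalClass_complexGysin_ratFamily)

namespace Summit.HodgeConjecture.HodgeConjecture.Cruxes.TwinSimilitudeAlgebraic.Disproof

/-! ## §1 Normal forms of X -/

/-- `SimAlgAt[c]`: the similitude crux at ONE multiplier `c : ℂ` — verbatim the local notation of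
`NikulinTwinTransportHodgeSimilitudeAlgebraicPrimes` / `Negative/NoAntisimilitude` (so that their
theorems apply symbol for symbol). `SimAlgAt[2]` is literally the body of X. Local notation only. -/
local notation3 (prettyPrint := false) "SimAlgAt[" c "]" =>
  ∀ (μ : OrientationFamily), μ.HasPoincareDuality →
    ∀ (S S' : SchemeOver ℂ)
      (hS : (IsSmoothProjective 2 S ∧ Subsingleton (structureSheafCohomology S.left 1) ∧
        ∃ (A : HodgeModel 2 S) (η : MForm 𝓘(ℝ, A.model) A.carrier ℂ 2),
          IsHolomorphicInCharts η ∧ ∀ x, η x ≠ 0))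
      (hS' : (IsSmoothProjective 2 S' ∧ Subsingleton (structureSheafCohomology S'.left 1) ∧
        ∃ (A : HodgeModel 2 S') (η : MForm 𝓘(ℝ, A.model) A.carrier ℂ 2),
          IsHolomorphicInCharts η ∧ ∀ x, η x ≠ 0))
      (p : complexBetti S (2 * 2)) (p' : complexBetti S' (2 * 2)),
      (IsIntegralClass p ∧ ∀ q : complexBetti S (2 * 2), IsIntegralClass q → ∃ n : ℤ, q = n • p) →
      (IsIntegralClass p' ∧
        ∀ q : complexBetti S' (2 * 2), IsIntegralClass q → ∃ n : ℤ, q = n • p') →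
      ∀ (ψ : complexBetti S' (2 * 1) →ₗ[ℂ] complexBetti S (2 * 1)),
        (∀ x, IsRationalClass x → IsRationalClass (ψ x)) →
        (∀ (i j : ℕ) x, IsOfHodgeType 2 S' (2 * 1) i j x → IsOfHodgeType 2 S (2 * 1) i j (ψ x)) →
        (∀ (x y : complexBetti S' (2 * 1)) (a : ℂ),
          cupProduct (rfl : 2 * 1 + 2 * 1 = 2 * 2) x y = a • p' →
            cupProduct (rfl : 2 * 1 + 2 * 1 = 2 * 2) (ψ x) (ψ y) = (c * a) • p) →
        ∃ γ ∈ algebraicClasses (MonoidalCategoryStruct.tensorObj S S') 2,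
          ∀ x : complexBetti S' (2 * 1),
            ψ x = complexGysin μ (IsSmoothProjective.tensor_holds hS.1 hS'.1) hS.1
              (SemiCartesianMonoidalCategory.fst S S')
              (rfl : 2 * 1 + 2 * 2 + 2 * 2 = 2 * 1 + 2 * (2 + 2))
              (cupProduct (rfl : 2 * 1 + 2 * 2 = 2 * 1 + 2 * 2)
                (complexBetti.map (SemiCartesianMonoidalCategory.snd S S') (2 * 1) x) γ)

/-- X is the multiplier-`2` slice of the similitude crux (landed `simAlgAt_two_iff`, `Iff.rfl`).
[folklore] -/
theorem crux_iff_simAlgAt_two : TwinSimilitudeAlgebraic ↔ SimAlgAt[(2 : ℂ)] :=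
  simAlgAt_two_iff.symm

/-- **The sign of the multiplier is not a degree of freedom of X.** X is ALSO the multiplier-`(−2)`
slice: its `∀ p p′` quantifier ranges over both integral generators of `H⁴(S(ℂ); ℤ) ≅ ℤ`, and
`p ↦ −p` exchanges the slices (`simAlgAt_neg_iff`, no K3 fact used). So a refuter cannot attack X
through an "anti-similitude" reading — that reading IS X. [folklore] -/
theorem crux_iff_simAlgAt_neg_two : TwinSimilitudeAlgebraic ↔ SimAlgAt[-(2 : ℂ)] :=
  simAlgAt_two_iff.symm.trans (simAlgAt_neg_iff (2 : ℂ)).symm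

/-- X follows from the all-multipliers crux (landed, prover seat; re-exported as an existence check
of the cited declaration). [folklore] -/
theorem crux_of_hodgeSimilitudeAlgebraic (h : HodgeSimilitudeAlgebraic) : TwinSimilitudeAlgebraic :=
  twinSimilitudeAlgebraic_of_hodgeSimilitudeAlgebraic h

/-! ## §2 The sign branches of `∀ p p′` are vacuous (multiplier `−2` relative to markings) -/

/-- **No rational `(−2)`-similitude between marked K3 surfaces** — the X-instance (`c = −2`) of the
sibling's landed `no_antisimilitude_of_markings` (`22 < 19 + 19` pairwise orthogonal negative
vectors): if `ψ` maps rational classes to rational classes, it cannot satisfy X's similitude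
hypothesis with the generator pair `(−p₀, p₀′)`, `p₀, p₀′` the generators of two markings. Hence in
X's `∀ p p′` only the branches `(±p₀, ±p₀′)` (same signs) carry content, and these are exchanged by
`crux_iff_simAlgAt_neg_two`. Markings are DATA here (for actual K3 surfaces: named fact
`Huybrechts_K3_marking_exists`). [cite: Huybrechts2016K3, Ch. 14 §0.3 (vi)] [cite: Buskin2019, §6.2] -/
theorem signBranch_vacuous {S S' : SchemeOver ℂ} (hS : IsK3Surface S)
    (η : complexBetti S (2 * 1) ≃ₗ[ℂ] (K3Index → ℂ)) (p₀ : complexBetti S (2 * 2)) (hp₀ : p₀ ≠ 0)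
    (hη : ∀ c : complexBetti S (2 * 1), IsIntegralClass c ↔ ∃ v : K3Index → ℤ, η c = fun i => (v i : ℂ))
    (hηcup : ∀ a b : complexBetti S (2 * 1),
      cupProduct (rfl : 2 * 1 + 2 * 1 = 2 * 2) a b = k3Form (η a) (η b) • p₀)
    (η' : complexBetti S' (2 * 1) ≃ₗ[ℂ] (K3Index → ℂ)) (p₀' : complexBetti S' (2 * 2))
    (hη' : ∀ c : complexBetti S' (2 * 1), IsIntegralClass c ↔ ∃ v : K3Index → ℤ, η' c = fun i => (v i : ℂ))
    (hη'cup : ∀ a b : complexBetti S' (2 * 1),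
      cupProduct (rfl : 2 * 1 + 2 * 1 = 2 * 2) a b = k3Form (η' a) (η' b) • p₀')
    (ψ : complexBetti S' (2 * 1) →ₗ[ℂ] complexBetti S (2 * 1))
    (hψr : ∀ x, IsRationalClass x → IsRationalClass (ψ x))
    (hψs : ∀ (x y : complexBetti S' (2 * 1)) (a : ℂ),
      cupProduct (rfl : 2 * 1 + 2 * 1 = 2 * 2) x y = a • p₀' →
        cupProduct (rfl : 2 * 1 + 2 * 1 = 2 * 2) (ψ x) (ψ y) = ((2 : ℂ) * a) • (-p₀)) : False := by
  refine no_antisimilitude_of_markings hS η p₀ hp₀ hη hηcup η' p₀' hη' hη'cup ψ hψr (c := -2)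
    (by norm_num) fun x y a h => ?_
  rw [hψs x y a h, smul_neg, ← neg_smul]
  congr 1
  push_cast
  ring


/-! ## §3 `htype` is load-bearing at multiplier 2 -/

/-- `TwinSimilitudeAlgebraicWithoutHtype`: the crux X with its type-preservation hypothesis `htype`
DROPPED, everything else verbatim (= the body of the route decl minus one binder). [folklore] -/
def TwinSimilitudeAlgebraicWithoutHtype : Prop :=
  ∀ (μ : OrientationFamily), μ.HasPoincareDuality →
    ∀ (S S' : SchemeOver ℂ)
      (hS : (IsSmoothProjective 2 S ∧ Subsingleton (structureSheafCohomology S.left 1) ∧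
        ∃ (A : HodgeModel 2 S) (η : MForm 𝓘(ℝ, A.model) A.carrier ℂ 2),
          IsHolomorphicInCharts η ∧ ∀ x, η x ≠ 0))
      (hS' : (IsSmoothProjective 2 S' ∧ Subsingleton (structureSheafCohomology S'.left 1) ∧
        ∃ (A : HodgeModel 2 S') (η : MForm 𝓘(ℝ, A.model) A.carrier ℂ 2),
          IsHolomorphicInCharts η ∧ ∀ x, η x ≠ 0))
      (p : complexBetti S (2 * 2)) (p' : complexBetti S' (2 * 2)),
      (IsIntegralClass p ∧ ∀ q : complexBetti S (2 * 2), IsIntegralClass q → ∃ n : ℤ, q = n • p) →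
      (IsIntegralClass p' ∧
        ∀ q : complexBetti S' (2 * 2), IsIntegralClass q → ∃ n : ℤ, q = n • p') →
      ∀ (ψ : complexBetti S' (2 * 1) →ₗ[ℂ] complexBetti S (2 * 1)),
        (∀ x, IsRationalClass x → IsRationalClass (ψ x)) →
        (∀ (x y : complexBetti S' (2 * 1)) (a : ℂ),
          cupProduct (rfl : 2 * 1 + 2 * 1 = 2 * 2) x y = a • p' →
            cupProduct (rfl : 2 * 1 + 2 * 1 = 2 * 2) (ψ x) (ψ y) = ((2 : ℂ) * a) • p) →
        ∃ γ ∈ algebraicClasses (MonoidalCategoryStruct.tensorObj S S') 2,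
          ∀ x : complexBetti S' (2 * 1),
            ψ x = complexGysin μ (IsSmoothProjective.tensor_holds hS.1 hS'.1) hS.1
              (SemiCartesianMonoidalCategory.fst S S')
              (rfl : 2 * 1 + 2 * 2 + 2 * 2 = 2 * 1 + 2 * (2 + 2))
              (cupProduct (rfl : 2 * 1 + 2 * 2 = 2 * 1 + 2 * 2)
                (complexBetti.map (SemiCartesianMonoidalCategory.snd S S') (2 * 1) x) γ)

/-- Shape check: the mutilated statement implies the crux (dropping a hypothesis only strengthens);
so `¬ TwinSimilitudeAlgebraicWithoutHtype` below is information about PROOFS of X, not about X.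
[folklore] -/
theorem twinSimilitudeAlgebraic_of_withoutHtype (h : TwinSimilitudeAlgebraicWithoutHtype) :
    TwinSimilitudeAlgebraic :=
  fun μ hμ S S' hS hS' p p' hp hp' ψ hr _ hs => h μ hμ S S' hS hS' p p' hp hp' ψ hr hs

/-- The explicit projective CM period vector `x₀ = (e₁ + f₁) + i (e₂ + f₂)` (verbatim the local
notation of `Negative/FalseWithoutHtype`). Local notation only. -/
local notation3 (prettyPrint := false) "x₀P" =>
  (Sum.elim 0 (Sum.elim ![1, 1] (Sum.elim ![Complex.I, Complex.I] 0)) : K3Index → ℂ)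

/-- The lattice vector `w = e₁ + f₁`. Local notation only. -/
local notation3 (prettyPrint := false) "wV" =>
  (Sum.elim 0 (Sum.elim ![1, 1] (Sum.elim 0 0)) : K3Index → ℤ)

/-- The lattice vector `u = e₃ + f₃ ⊥ x₀`, `u² = 2`. Local notation only. -/
local notation3 (prettyPrint := false) "uV" =>
  (Sum.elim 0 (Sum.elim 0 (Sum.elim 0 ![1, 1])) : K3Index → ℤ)

/-- **`htype` is load-bearing for X (multiplier 2).** Granted the five named facts of the sibling
lemma `hodgeSimilitudeAlgebraic_false_without_htype_at_one` (projective surjectivity of the K3 period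
map, independence of `H^{p,q}` of the Hodge model, existence of Hodge models, de Rham's theorem,
Grothendieck's coniveau fact `N²H⁴ ⊆ H^{2,2}`) and an orientation family with Poincaré duality, the
crux X WITHOUT its type-preservation hypothesis is FALSE. Proof: on the marked projective K3 surface
`(S, φ)` with period `x₀ = (e₁+f₁) + i(e₂+f₂)`, EVERY endomorphism `ρ` of `Λ_ℂ` defined over `ℚ`
that doubles the K3 form yields a rational `2`-similitude `ψ_ρ = φ⁻¹ ∘ ρ ∘ φ` of `H²(S(ℂ); ℂ)` to
itself (`isRationalClass_markingConj`, `cupProduct_markingConj`); the mutilated crux makes `ψ_ρ`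
algebraic, hence type-preserving on the `(2,0)`-line (`isOfHodgeType_complexGysin` & co.), i.e.
`ρ x₀ ∈ ℂ x₀`. Apply this to the explicit rational lattice `2`-similitude `M`
(`exists_twoSimilitude_k3Lattice`: sum/difference on `E₈(−1)²`, `diag(1,2)` on each `U`) and to
`M ∘ s_w` (`w = e₁ + f₁`): with the rational inverse `N` of `M` one gets `s_w x₀ ∈ ℂ x₀`,
contradicting `reflection_x₀P_ne_smul` (`s_w x₀ = x₀ − 2w`). So any proof of X must use `htype`
(multiplier-2 companion of the landed multiplier-1 lemma; no lattice matrix is unfolded here).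
[cite: VoisinHodgeI2002, §7.3.2 and Prop. 11.20] [cite: Huybrechts2016K3, Ch. 6 Rem. 3.3] -/
theorem twinSimilitudeAlgebraic_false_without_htype
    (hP : Huybrechts_K3_periodSurjective_projective)
    (hI : hodgePQ_independent_of_hodgeModel)
    (hM : ∀ (m : ℕ) (Y : SchemeOver ℂ), nonempty_hodgeModel m Y)
    (hdR : ∀ (E : Type) [NormedAddCommGroup E] [NormedSpace ℂ E] [FiniteDimensional ℂ E],
      exists_deRhamIsoFamily 𝓘(ℝ, E))
    (hG : Grothendieck1969_supportedClasses_le_hodgeConiveau)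
    (μ : OrientationFamily) (hμ : μ.HasPoincareDuality) :
    ¬ TwinSimilitudeAlgebraicWithoutHtype := by
  intro h
  -- a marked projective K3 surface with period `x₀`
  obtain ⟨S, hS, φ, p, hpint, hpgen, hφint, hφcup, h20, h20span⟩ :=
    hP x₀P x₀P_sq x₀P_pos ⟨uV, uV_x₀P, uV_sq⟩
  have hp0 : p ≠ 0 := generator_ne_zero hS hpgen
  -- KEY: under `h`, every `ρ ∈ End(Λ_ℂ)` defined over `ℚ` doubling the form preserves the period line
  have key : ∀ ρ : Module.End ℂ (K3Index → ℂ),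
      (∀ v : K3Index → ℤ, ∃ w : K3Index → ℚ, ρ (fun i => (v i : ℂ)) = fun i => (w i : ℂ)) →
      (∀ a b, k3Form (ρ a) (ρ b) = 2 * k3Form a b) → ∃ t : ℂ, ρ x₀P = t • x₀P := by
    intro ρ hρrat hρ2
    set ψ : complexBetti S (2 * 1) →ₗ[ℂ] complexBetti S (2 * 1) :=
      φ.symm.toLinearMap ∘ₗ ρ ∘ₗ φ.toLinearMap with hψ
    have hψapply : ∀ y, ψ y = φ.symm (ρ (φ y)) := fun y => rfl
    have hrat : ∀ y, IsRationalClass y → IsRationalClass (ψ y) := by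
      intro y hy
      rw [hψapply]
      exact isRationalClass_markingConj φ φ ρ hS hS hφint hφint hρrat hy
    have hsim : ∀ (x y : complexBetti S (2 * 1)) (a : ℂ),
        cupProduct (rfl : 2 * 1 + 2 * 1 = 2 * 2) x y = a • p →
          cupProduct (rfl : 2 * 1 + 2 * 1 = 2 * 2) (ψ x) (ψ y) = ((2 : ℂ) * a) • p := by
      intro x y a hxy
      rw [hψapply, hψapply]
      exact cupProduct_markingConj φ p φ p ρ hp0 hφcup hφcup hρ2 x y a hxy
    -- the mutilated crux makes `ψ` algebraic
    obtain ⟨γ, hγ, hψγ⟩ := h μ hμ S S hS hS p p ⟨hpint, hpgen⟩ ⟨hpint, hpgen⟩ ψ hrat hsim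
    -- `γ ∈ N²H⁴(S × S)` is of type `(2,2)` (Grothendieck's coniveau fact)
    have hSS : IsSmoothProjective (2 + 2) (S ⊗ S) := IsSmoothProjective.tensor_holds hS.1 hS.1
    obtain ⟨A⟩ := (hM (2 + 2) (S ⊗ S)).nonempty hSS
    have hγT : IsOfHodgeType (2 + 2) (S ⊗ S) (2 * 2) 2 2 γ := by
      have hc : A.pullback (2 * 2) γ ∈ A.hodgeConiveau (2 * 2) 2 := hG hSS A (2 * 2) 2 ⟨γ, hγ, rfl⟩
      have hle : A.hodgeConiveau (2 * 2) 2 ≤ A.hodgePQ (2 * 2) 2 2 := by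
        refine iSup_le fun p₁ => iSup_le fun q₁ => iSup_le fun hpq => iSup_le fun hp₁ =>
          iSup_le fun hq₁ => ?_
        obtain ⟨rfl, rfl⟩ : p₁ = 2 ∧ q₁ = 2 := by omega
        exact le_rfl
      exact ⟨A, hle hc⟩
    -- `snd^*(φ⁻¹ x₀)` is of type `(2,0)`, its cup with `γ` of type `(4,2)`, `fst_*` of that of type `(2,0)`
    have hsndT : IsOfHodgeType (2 + 2) (S ⊗ S) (2 * 1) 2 0
        (complexBetti.map (SemiCartesianMonoidalCategory.snd S S) (2 * 1) (φ.symm x₀P)) :=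
      IsOfHodgeType.map_of_independent hI h20 hSS hS.1 A (SemiCartesianMonoidalCategory.snd S S)
    have hcupT := cupPreservesHodgeType_of_nonempty_hodgeModel hI (hM (2 + 2) (S ⊗ S)) hdR hSS
      (rfl : 2 * 1 + 2 * 2 = 2 * 1 + 2 * 2) hsndT hγT
    have hgysT : IsOfHodgeType 2 S (2 * 1) 2 0 (ψ (φ.symm x₀P)) := by
      rw [hψγ]
      exact isOfHodgeType_complexGysin hI hM hdR μ hSS hS.1 (SemiCartesianMonoidalCategory.fst S S)
        (rfl : 2 * 1 + 2 * 2 + 2 * 2 = 2 * 1 + 2 * (2 + 2)) (by norm_num) (by norm_num) hcupT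
    -- hence `ρ x₀ ∈ ℂ x₀`
    obtain ⟨t, ht⟩ := h20span _ hgysT
    refine ⟨t, ?_⟩
    rw [hψapply, LinearEquiv.apply_symm_apply] at ht
    have ht' := congrArg φ ht
    rwa [LinearEquiv.apply_symm_apply, map_smul, LinearEquiv.apply_symm_apply] at ht'
  -- the explicit rational `2`-similitude `M` of `Λ` (rational inverse `N`) and its composite with `s_w`
  obtain ⟨M, N, hMrat, -, -, hNM, hM2⟩ := exists_twoSimilitude_k3Lattice
  have hsrat : ∀ v : K3Index → ℤ, ∃ w : K3Index → ℚ,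
      k3ReflectionC wV (fun i => (v i : ℂ)) = fun i => (w i : ℂ) := fun v =>
    ⟨reflection k3FormRat (fun j => (wV j : ℚ)) (fun i => (v i : ℚ)), by
      rw [intCast_eq_ratCast_intCast v, k3ReflectionC_ratCast]⟩
  have hMsrat := ratEnd_mul M (k3ReflectionC wV) hMrat hsrat
  have hMs2 : ∀ a b, k3Form ((M * k3ReflectionC wV) a) ((M * k3ReflectionC wV) b) = 2 * k3Form a b := by
    intro a b
    rw [Module.End.mul_apply, Module.End.mul_apply, hM2, k3Form_k3ReflectionC]
  obtain ⟨t₁, ht₁⟩ := key M hMrat hM2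
  obtain ⟨t₂, ht₂⟩ := key (M * k3ReflectionC wV) hMsrat hMs2
  rw [Module.End.mul_apply] at ht₂
  -- apply the inverse `N`: `x₀ = t₁ • N x₀`, `s_w x₀ = t₂ • N x₀`
  have hx0 : (x₀P) ≠ 0 := ne_zero_of_star_self_re_pos x₀P_pos
  have hN1 : N (M x₀P) = x₀P := by rw [← Module.End.mul_apply, hNM, Module.End.one_apply]
  have hN2 : N (M (k3ReflectionC wV x₀P)) = k3ReflectionC wV x₀P := by
    rw [← Module.End.mul_apply, hNM, Module.End.one_apply]
  rw [ht₁, map_smul] at hN1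
  rw [ht₂, map_smul] at hN2
  have ht₁0 : t₁ ≠ 0 := by
    rintro rfl
    rw [zero_smul] at hN1
    exact hx0 hN1.symm
  refine reflection_x₀P_ne_smul (t₂ * t₁⁻¹) ?_
  calc k3ReflectionC wV x₀P = t₂ • N x₀P := hN2.symm
    _ = t₂ • (t₁⁻¹ • (t₁ • N x₀P)) := by rw [smul_smul t₁⁻¹ t₁, inv_mul_cancel₀ ht₁0, one_smul]
    _ = (t₂ * t₁⁻¹) • x₀P := by rw [hN1, smul_smul]

/-! ## §3b `hrat` is load-bearing (non-CM witness, certified) -/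

/-- `√2` as a complex number. Local notation only. -/
local notation3 (prettyPrint := false) "s2" => ((Real.sqrt 2 : ℝ) : ℂ)

/-- The explicit NON-CM projective period `x₁ = (e₁+f₁) + i(√2(e₂+f₂) + (e₂−f₂))`. -/
local notation3 (prettyPrint := false) "x₁P" =>
  (Sum.elim 0 (Sum.elim ![1, 1] (Sum.elim ![(s2 + 1) * Complex.I, (s2 - 1) * Complex.I] 0)) : K3Index → ℂ)

/-- `a = e₁ + f₁`. -/
local notation3 (prettyPrint := false) "aV" =>
  (Sum.elim 0 (Sum.elim ![1, 1] (Sum.elim 0 0)) : K3Index → ℤ)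
/-- `b = e₂ + f₂`. -/
local notation3 (prettyPrint := false) "bV" =>
  (Sum.elim 0 (Sum.elim 0 (Sum.elim ![1, 1] 0)) : K3Index → ℤ)
/-- `d = e₂ - f₂`. -/
local notation3 (prettyPrint := false) "dV" =>
  (Sum.elim 0 (Sum.elim 0 (Sum.elim ![1, -1] 0)) : K3Index → ℤ)

theorem s2_mul_s2 : s2 * s2 = 2 := by
  rw [← Complex.ofReal_mul, Real.mul_self_sqrt (by norm_num : (0:ℝ) ≤ 2)]
  norm_num

theorem star_s2 : star s2 = s2 := Complex.conj_ofReal _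

theorem s2_sq : s2 ^ 2 = 2 := by rw [sq, s2_mul_s2]

/-- `(x₁.x₁) = 0`. -/
theorem x₁P_sq : k3Form x₁P x₁P = 0 := by
  simp [k3Form, k3Gram, hyperbolicPlaneGram, Fintype.sum_sum_type, Fin.sum_univ_two]
  ring_nf
  rw [Complex.I_sq, s2_sq]
  ring

theorem star_x₁P : star x₁P =
    (Sum.elim 0 (Sum.elim ![1, 1] (Sum.elim ![-((s2 + 1) * Complex.I), -((s2 - 1) * Complex.I)] 0)) :
      K3Index → ℂ) := by
  funext i
  rcases i with ((i|i)|(i|(i|i))) <;> fin_cases i <;> simp [star_s2]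

/-- `(x̄₁.x₁) = 4`. -/
theorem k3Form_star_x₁P_x₁P : k3Form (star x₁P) x₁P = 4 := by
  rw [star_x₁P]
  simp [k3Form, k3Gram, hyperbolicPlaneGram, Fintype.sum_sum_type, Fin.sum_univ_two]
  ring_nf
  rw [Complex.I_sq, s2_sq]
  ring

/-- `(x₁.x̄₁) = 4`. -/
theorem k3Form_x₁P_star_x₁P : k3Form x₁P (star x₁P) = 4 := by
  rw [k3Form_comm, k3Form_star_x₁P_x₁P]

/-- `(x̄₁.x̄₁) = 0`. -/
theorem k3Form_star_x₁P_star_x₁P : k3Form (star x₁P) (star x₁P) = 0 := by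
  rw [← star_k3Form, x₁P_sq, star_zero]

/-- `re (x̄₁.x₁) = 4 > 0`. -/
theorem x₁P_pos : 0 < (k3Form (star x₁P) x₁P).re := by
  rw [k3Form_star_x₁P_x₁P]; norm_num

/-- `(u.x₁) = 0` for `u = e₃ + f₃`. -/
theorem uV_x₁P : k3Form (fun i => (uV i : ℂ)) x₁P = 0 := by
  simp [k3Form, k3Gram, hyperbolicPlaneGram, Fintype.sum_sum_type, Fin.sum_univ_two]

/-- `(a.x₁) = 2`, `(x₁.a) = 2`, `(a.x̄₁) = 2`, `(x̄₁.a) = 2` for `a = e₁ + f₁`. -/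
theorem k3Form_aV_x₁P : k3Form (fun i => (aV i : ℂ)) x₁P = 2 := by
  simp [k3Form, k3Gram, hyperbolicPlaneGram, Fintype.sum_sum_type, Fin.sum_univ_two]; norm_num

theorem k3Form_x₁P_aV : k3Form x₁P (fun i => (aV i : ℂ)) = 2 := by
  rw [k3Form_comm, k3Form_aV_x₁P]

theorem k3Form_star_x₁P_aV : k3Form (star x₁P) (fun i => (aV i : ℂ)) = 2 := by
  rw [star_x₁P]
  simp [k3Form, k3Gram, hyperbolicPlaneGram, Fintype.sum_sum_type, Fin.sum_univ_two]; norm_num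

/-- `x₁ = a + i (√2 b + d)` with `a = e₁+f₁`, `b = e₂+f₂`, `d = e₂−f₂`. -/
theorem x₁P_decomp : x₁P = (fun i => (aV i : ℂ)) +
    Complex.I • (s2 • (fun i => (bV i : ℂ)) + (fun i => (dV i : ℂ))) := by
  funext i
  rcases i with ((i|i)|(i|(i|i))) <;> fin_cases i <;> simp <;> ring

/-! ### The non-rational type-preserving isometry `R` (`t = 2`) -/

/-- `R v = v + ¼ (x̄₁.v) x₁ − ⅛ (x₁.v) x̄₁`: acts by `2` on `x₁`, by `½` on `x̄₁`, by `1` on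
`{x₁, x̄₁}^⊥`; an isometry of `(Λ_ℂ, k3Form)` NOT defined over `ℚ` (nor over `ℝ`). -/
def twistR : Module.End ℂ (K3Index → ℂ) :=
  1 + (4 : ℂ)⁻¹ • (k3FormC (star x₁P)).smulRight x₁P +
    (-(8 : ℂ)⁻¹) • (k3FormC x₁P).smulRight (star x₁P)

theorem twistR_apply (v : K3Index → ℂ) :
    twistR v = v + ((4 : ℂ)⁻¹ * k3Form (star x₁P) v) • x₁P +
      (-(8 : ℂ)⁻¹ * k3Form x₁P v) • star x₁P := by
  simp only [twistR, LinearMap.add_apply, LinearMap.smul_apply, LinearMap.smulRight_apply,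
    k3FormC_apply, Module.End.one_apply, smul_smul]

theorem twistR_x₁P : twistR x₁P = (2 : ℂ) • x₁P := by
  rw [twistR_apply, k3Form_star_x₁P_x₁P, x₁P_sq, mul_zero, zero_smul, add_zero]
  rw [show (2 : ℂ) • x₁P = x₁P + (1 : ℂ) • x₁P by rw [one_smul, ← two_smul ℂ]]
  congr 1
  norm_num

theorem twistR_star_x₁P : twistR (star x₁P) = (2 : ℂ)⁻¹ • star x₁P := by
  rw [twistR_apply, k3Form_star_x₁P_star_x₁P, k3Form_x₁P_star_x₁P, mul_zero, zero_smul, add_zero]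
  rw [show (-(8 : ℂ)⁻¹ * 4) = (2 : ℂ)⁻¹ - 1 by norm_num, sub_smul, one_smul]
  abel

/-- `R` is an isometry of the complex K3 form. -/
theorem k3Form_twistR (v w : K3Index → ℂ) : k3Form (twistR v) (twistR w) = k3Form v w := by
  have e1 : k3Form v x₁P = k3Form x₁P v := k3Form_comm _ _
  have e2 : k3Form v (star x₁P) = k3Form (star x₁P) v := k3Form_comm _ _
  rw [twistR_apply, twistR_apply]
  simp only [k3Form_add_left, k3Form_add_right, k3Form_smul_left, k3Form_smul_right, x₁P_sq,
    k3Form_star_x₁P_star_x₁P, k3Form_x₁P_star_x₁P, k3Form_star_x₁P_x₁P, e1, e2]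
  ring

/-- `R a = a + ½ x₁ − ¼ x̄₁` for `a = e₁ + f₁`. -/
theorem twistR_aV : twistR (fun i => (aV i : ℂ)) =
    (fun i => (aV i : ℂ)) + (2 : ℂ)⁻¹ • x₁P + (-(4 : ℂ)⁻¹) • star x₁P := by
  rw [twistR_apply, k3Form_star_x₁P_aV, k3Form_x₁P_aV]
  norm_num

/-- The `e₂`-coordinate of `R a` is `¾ (√2 + 1) i ≠ 0` (so `R a ∉ ℂ a` and `R a ∉ Λ_ℚ`). -/
theorem twistR_aV_e₂ : twistR (fun i => (aV i : ℂ)) (Sum.inr (Sum.inr (Sum.inl 0))) =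
    (3 / 4 : ℂ) * ((s2 + 1) * Complex.I) := by
  rw [twistR_aV, star_x₁P]
  simp
  ring

theorem twistR_aV_e₂_ne_zero : twistR (fun i => (aV i : ℂ)) (Sum.inr (Sum.inr (Sum.inl 0))) ≠ 0 := by
  rw [twistR_aV_e₂]
  refine mul_ne_zero (by norm_num) (mul_ne_zero ?_ Complex.I_ne_zero)
  intro h
  have h1 : (Real.sqrt 2 : ℝ) + 1 = 0 := by exact_mod_cast h
  have h2 : (0 : ℝ) ≤ Real.sqrt 2 := Real.sqrt_nonneg 2
  linarith


/-! ### KEY LEMMA: `End_Hdg(T) = ℚ` at the period `x₁`, elementary form -/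

/-- **Key lemma.** An endomorphism `G` of `Λ_ℂ` defined over `ℚ` having the period `x₁` as an
eigenvector, `G x₁ = λ x₁`, acts on `a = e₁ + f₁` by the same scalar: `G a = λ a` (and `λ` is
real). Proof: `G x₁ = G a + i(√2 G b + G d)` with `G a, G b, G d ∈ Λ_ℚ`; the real parts of the
`e₂`- and `f₂`-coordinates give `(Ga)_{e₂} = −Im λ (√2+1)`, `(Ga)_{f₂} = −Im λ (√2−1)`, so
`Im λ ≠ 0` would make `√2 = ((Ga)_{e₂} + (Ga)_{f₂}) / ((Ga)_{e₂} − (Ga)_{f₂})` rational; hence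
`Im λ = 0` and the real parts of all coordinates give `G a = (Re λ) a`. [folklore] -/
theorem ratEnd_aV_of_eigen (G : Module.End ℂ (K3Index → ℂ))
    (hG : ∀ v : K3Index → ℤ, ∃ w : K3Index → ℚ, G (fun i => (v i : ℂ)) = fun i => (w i : ℂ))
    {lam : ℂ} (h : G x₁P = lam • x₁P) :
    G (fun i => (aV i : ℂ)) = lam • fun i => (aV i : ℂ) := by
  obtain ⟨wa, hwa⟩ := hG aV
  obtain ⟨wb, hwb⟩ := hG bV
  obtain ⟨wd, hwd⟩ := hG dV
  -- `G x₁ = G a + I • (s2 • G b + G d)`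
  have hGx : G x₁P = (fun i => (wa i : ℂ)) +
      Complex.I • (s2 • (fun i => (wb i : ℂ)) + fun i => (wd i : ℂ)) := by
    rw [x₁P_decomp, map_add, map_smul, map_add, map_smul, hwa, hwb, hwd]
  rw [hGx] at h
  have hc : ∀ i, (wa i : ℂ) + Complex.I * (s2 * (wb i : ℂ) + (wd i : ℂ)) = lam * x₁P i := fun i => by
    have := congrFun h i
    simp only [Pi.add_apply, Pi.smul_apply, smul_eq_mul] at this
    exact this
  -- real parts at `e₂` and `f₂`
  have hre1 : (wa (Sum.inr (Sum.inr (Sum.inl 0))) : ℝ) = -(lam.im * (Real.sqrt 2 + 1)) := by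
    have := congrArg Complex.re (hc (Sum.inr (Sum.inr (Sum.inl 0))))
    simpa using this
  have hre2 : (wa (Sum.inr (Sum.inr (Sum.inl 1))) : ℝ) = -(lam.im * (Real.sqrt 2 - 1)) := by
    have := congrArg Complex.re (hc (Sum.inr (Sum.inr (Sum.inl 1))))
    simpa using this
  -- `Im λ = 0`, by irrationality of `√2`
  have him : lam.im = 0 := by
    by_contra hne
    set p : ℚ := wa (Sum.inr (Sum.inr (Sum.inl 0))) with hp
    set q : ℚ := wa (Sum.inr (Sum.inr (Sum.inl 1))) with hq
    have hd : ((p : ℝ) - q) = -2 * lam.im := by linear_combination hre1 - hre2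
    have hs : ((p : ℝ) + q) = (-2 * lam.im) * Real.sqrt 2 := by linear_combination hre1 + hre2
    have hd0 : ((p : ℝ) - q) ≠ 0 := by rw [hd]; exact mul_ne_zero (by norm_num) hne
    have hsq : Real.sqrt 2 = ((p : ℝ) + q) / ((p : ℝ) - q) := by
      rw [eq_div_iff hd0, hd, hs]; ring
    exact irrational_sqrt_two.ne_rat ((p + q) / (p - q)) (by rw [hsq]; push_cast; rfl)
  -- real parts of all coordinates: `G a = (Re λ) a`
  have hlam : lam = (lam.re : ℂ) := Complex.ext (by simp) (by simp [him])
  rw [hwa]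
  funext i
  have hi := hc i
  have hxi : x₁P i = (aV i : ℂ) + Complex.I * (s2 * (bV i : ℂ) + (dV i : ℂ)) := by
    have := congrFun x₁P_decomp i
    simp only [Pi.add_apply, Pi.smul_apply, smul_eq_mul] at this
    exact this
  rw [hxi] at hi
  have hre := congrArg Complex.re hi
  simp [him] at hre
  rw [Pi.smul_apply, smul_eq_mul, hlam]
  apply Complex.ext
  · simpa using hre
  · simp


/-! ### Hodge types of `η⁻¹ ∘ ρ ∘ η'` without reality of `ρ` -/

/-- **`η⁻¹ ∘ ρ ∘ η'` preserves every Hodge type** — variant of `isOfHodgeType_markingConj` in which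
the reality of `ρ` (used there through `ratEnd_star`) is replaced by the two eigen-relations
`ρ x' = t x`, `ρ x̄' = t' x̄` (`t, t' ≠ 0`): then `H^{2,0} = ℂσ' ↦ ℂσ`, `H^{0,2} = ℂσ̄' ↦ ℂσ̄`, and
`H^{1,1} = ⟨σ', σ̄'⟩^⊥ ↦ ⟨σ, σ̄⟩^⊥` because `ρ` is a similitude (`x = t⁻¹ρx'`, `x̄ = t'⁻¹ρx̄'`).
For `ρ` real, `t' = t̄` and this is the landed lemma. [cite: Huybrechts2016K3, Ch. 6 Prop. 1.2] -/
theorem isOfHodgeType_markingConj_of_star {S S' : SchemeOver ℂ}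
    (η : complexBetti S (2 * 1) ≃ₗ[ℂ] (K3Index → ℂ)) (p : complexBetti S (2 * 2)) (x : K3Index → ℂ)
    (η' : complexBetti S' (2 * 1) ≃ₗ[ℂ] (K3Index → ℂ)) (p' : complexBetti S' (2 * 2))
    (x' : K3Index → ℂ) (ρ : Module.End ℂ (K3Index → ℂ))
    (hHT : Huybrechts_K3_hodgeTypes_H2) (hS : IsK3Surface S) (hS' : IsK3Surface S')
    (hη : ∀ c : complexBetti S (2 * 1), IsIntegralClass c ↔ ∃ v : K3Index → ℤ, η c = fun i => (v i : ℂ))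
    (hηcup : ∀ a b : complexBetti S (2 * 1),
      cupProduct (rfl : 2 * 1 + 2 * 1 = 2 * 2) a b = k3Form (η a) (η b) • p)
    (h20 : IsOfHodgeType 2 S (2 * 1) 2 0 (η.symm x)) (hx : 0 < (k3Form (star x) x).re)
    (hη' : ∀ c : complexBetti S' (2 * 1), IsIntegralClass c ↔ ∃ v : K3Index → ℤ, η' c = fun i => (v i : ℂ))
    (hη'cup : ∀ a b : complexBetti S' (2 * 1),
      cupProduct (rfl : 2 * 1 + 2 * 1 = 2 * 2) a b = k3Form (η' a) (η' b) • p')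
    (hp' : p' ≠ 0)
    (h20' : IsOfHodgeType 2 S' (2 * 1) 2 0 (η'.symm x')) (hx' : 0 < (k3Form (star x') x').re)
    {r : ℂ} (hρ : ∀ a b, k3Form (ρ a) (ρ b) = r * k3Form a b)
    {t t' : ℂ} (ht0 : t ≠ 0) (ht'0 : t' ≠ 0) (hper : ρ x' = t • x)
    (hper' : ρ (star x') = t' • star x) :
    ∀ (i j : ℕ) (y : complexBetti S' (2 * 1)),
      IsOfHodgeType 2 S' (2 * 1) i j y → IsOfHodgeType 2 S (2 * 1) i j (η.symm (ρ (η' y))) := by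
  have hσ0 : η.symm x ≠ 0 := fun h0 => ne_zero_of_star_self_re_pos hx (by simpa using congrArg η h0)
  have hσ'0 : η'.symm x' ≠ 0 := fun h0 =>
    ne_zero_of_star_self_re_pos hx' (by simpa using congrArg η' h0)
  have hxt : x = t⁻¹ • ρ x' := by rw [hper, smul_smul, inv_mul_cancel₀ ht0, one_smul]
  have hxt' : star x = t'⁻¹ • ρ (star x') := by rw [hper', smul_smul, inv_mul_cancel₀ ht'0, one_smul]
  obtain ⟨h1, h2, h3⟩ := hHT S hS (η.symm x) h20 hσ0
  obtain ⟨h1', h2', h3'⟩ := hHT S' hS' (η'.symm x') h20' hσ'0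
  intro i j y hy
  by_cases hij : i + j = 2 * 1
  · obtain ⟨rfl, rfl⟩ | ⟨rfl, rfl⟩ | ⟨rfl, rfl⟩ :
        (i = 2 ∧ j = 0) ∨ (i = 0 ∧ j = 2) ∨ (i = 1 ∧ j = 1) := by omega
    · -- type `(2,0)`
      obtain ⟨t₀, rfl⟩ := (h1' y).1 hy
      refine (h1 _).2 ⟨t₀ * t, ?_⟩
      rw [map_smul, LinearEquiv.apply_symm_apply, map_smul, hper, map_smul, map_smul, smul_smul]
    · -- type `(0,2)`
      obtain ⟨t₀, rfl⟩ := (h2' y).1 hy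
      refine (h2 _).2 ⟨t₀ * t', ?_⟩
      rw [map_smul, conjClass_marking_symm η' hη', LinearEquiv.apply_symm_apply, map_smul, hper',
        map_smul, map_smul, ← conjClass_marking_symm η hη, smul_smul]
    · -- type `(1,1)`
      obtain ⟨hc1, hc2⟩ := (h3' y).1 hy
      have hk1 : k3Form (η' y) x' = 0 := by
        rw [hη'cup, LinearEquiv.apply_symm_apply, smul_eq_zero] at hc1
        exact hc1.resolve_right hp'
      have hk2 : k3Form (η' y) (star x') = 0 := by
        rw [conjClass_marking_symm η' hη', hη'cup, LinearEquiv.apply_symm_apply, smul_eq_zero] at hc2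
        exact hc2.resolve_right hp'
      refine (h3 _).2 ⟨?_, ?_⟩
      · rw [hηcup, LinearEquiv.apply_symm_apply, LinearEquiv.apply_symm_apply, hxt,
          k3Form_smul_right, hρ, hk1, mul_zero, mul_zero, zero_smul]
      · rw [conjClass_marking_symm η hη, hηcup, LinearEquiv.apply_symm_apply,
          LinearEquiv.apply_symm_apply, hxt', k3Form_smul_right, hρ, hk2, mul_zero, mul_zero,
          zero_smul]
  · obtain rfl := isOfHodgeType_eq_zero_of_add_ne hy hij
    rw [map_zero, map_zero, map_zero]
    obtain ⟨A⟩ := hS.nonempty_hodgeModel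
    exact IsOfHodgeType.zero A _ _ _

/-! ### Main theorem: `hrat` is load-bearing for X -/

/-- `TwinSimilitudeAlgebraicWithoutHrat`: the crux X with its rationality hypothesis `hrat` DROPPED,
everything else verbatim. [folklore] -/
def TwinSimilitudeAlgebraicWithoutHrat : Prop :=
  ∀ (μ : OrientationFamily), μ.HasPoincareDuality →
    ∀ (S S' : SchemeOver ℂ)
      (hS : (IsSmoothProjective 2 S ∧ Subsingleton (structureSheafCohomology S.left 1) ∧
        ∃ (A : HodgeModel 2 S) (η : MForm 𝓘(ℝ, A.model) A.carrier ℂ 2),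
          IsHolomorphicInCharts η ∧ ∀ x, η x ≠ 0))
      (hS' : (IsSmoothProjective 2 S' ∧ Subsingleton (structureSheafCohomology S'.left 1) ∧
        ∃ (A : HodgeModel 2 S') (η : MForm 𝓘(ℝ, A.model) A.carrier ℂ 2),
          IsHolomorphicInCharts η ∧ ∀ x, η x ≠ 0))
      (p : complexBetti S (2 * 2)) (p' : complexBetti S' (2 * 2)),
      (IsIntegralClass p ∧ ∀ q : complexBetti S (2 * 2), IsIntegralClass q → ∃ n : ℤ, q = n • p) →
      (IsIntegralClass p' ∧
        ∀ q : complexBetti S' (2 * 2), IsIntegralClass q → ∃ n : ℤ, q = n • p') →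
      ∀ (ψ : complexBetti S' (2 * 1) →ₗ[ℂ] complexBetti S (2 * 1)),
        (∀ (i j : ℕ) x, IsOfHodgeType 2 S' (2 * 1) i j x → IsOfHodgeType 2 S (2 * 1) i j (ψ x)) →
        (∀ (x y : complexBetti S' (2 * 1)) (a : ℂ),
          cupProduct (rfl : 2 * 1 + 2 * 1 = 2 * 2) x y = a • p' →
            cupProduct (rfl : 2 * 1 + 2 * 1 = 2 * 2) (ψ x) (ψ y) = ((2 : ℂ) * a) • p) →
        ∃ γ ∈ algebraicClasses (MonoidalCategoryStruct.tensorObj S S') 2,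
          ∀ x : complexBetti S' (2 * 1),
            ψ x = complexGysin μ (IsSmoothProjective.tensor_holds hS.1 hS'.1) hS.1
              (SemiCartesianMonoidalCategory.fst S S')
              (rfl : 2 * 1 + 2 * 2 + 2 * 2 = 2 * 1 + 2 * (2 + 2))
              (cupProduct (rfl : 2 * 1 + 2 * 2 = 2 * 1 + 2 * 2)
                (complexBetti.map (SemiCartesianMonoidalCategory.snd S S') (2 * 1) x) γ)

/-- Shape check: the mutilated statement implies the crux. [folklore] -/
theorem twinSimilitudeAlgebraic_of_withoutHrat (h : TwinSimilitudeAlgebraicWithoutHrat) :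
    TwinSimilitudeAlgebraic :=
  fun μ hμ S S' hS hS' p p' hp hp' ψ _ ht hs => h μ hμ S S' hS hS' p p' hp hp' ψ ht hs

/-- **`hrat` is load-bearing for X** (modulo seven named facts): see the module docstring §3b and the
docstring of the landed copy `Negative/FalseWithoutHrat.lean`. Witness: non-CM period `x₁`, twin
`N x₁`, `ψ = φ⁻¹ R M φ′`; refuted at `μ = ratFamily` through the KEY LEMMA `ratEnd_aV_of_eigen`.
[cite: Huybrechts2016K3, Ch. 3 §3, Ch. 6 Prop. 1.2] [cite: VoisinHodgeI2002, §7.3.2 and Prop. 11.20] -/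
theorem twinSimilitudeAlgebraic_false_without_hrat
    (hP : Huybrechts_K3_periodSurjective_projective) (hHT : Huybrechts_K3_hodgeTypes_H2)
    (hI : hodgePQ_independent_of_hodgeModel)
    (hM : ∀ (m : ℕ) (Y : SchemeOver ℂ), nonempty_hodgeModel m Y)
    (hdR : ∀ (E : Type) [NormedAddCommGroup E] [NormedSpace ℂ E] [FiniteDimensional ℂ E],
      exists_deRhamIsoFamily 𝓘(ℝ, E))
    (hG : Grothendieck1969_supportedClasses_le_hodgeConiveau)
    (hspan : span_isRationalClass_eq_top_of_isSmoothProjective) :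
    ¬ TwinSimilitudeAlgebraicWithoutHrat := by
  intro h
  -- the lattice `2`-similitude and the twin periods `x₁`, `N x₁`
  obtain ⟨M, N, hMrat, hNrat, hMN, hNM, hM2⟩ := exists_twoSimilitude_k3Lattice
  have hMN' : ∀ v, M (N v) = v := fun v => by rw [← Module.End.mul_apply, hMN, Module.End.one_apply]
  have hNM' : ∀ v, N (M v) = v := fun v => by rw [← Module.End.mul_apply, hNM, Module.End.one_apply]
  have hN2 : ∀ a b, k3Form (N a) (N b) = (2 : ℂ)⁻¹ * k3Form a b := by
    intro a b
    have e := hM2 (N a) (N b)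
    rw [hMN', hMN'] at e
    rw [e, ← mul_assoc, inv_mul_cancel₀ (two_ne_zero' ℂ), one_mul]
  obtain ⟨hx'1, hx'2, hx'3⟩ :=
    periodPt_twin N hNrat hN2 (x := x₁P) ⟨x₁P_sq, x₁P_pos, uV, uV_x₁P, uV_sq⟩
  obtain ⟨S, hS, φ, p, hpint, hpgen, hφint, hφcup, h20, h20span⟩ :=
    hP x₁P x₁P_sq x₁P_pos ⟨uV, uV_x₁P, uV_sq⟩
  obtain ⟨S', hS', φ', p', hp'int, hp'gen, hφ'int, hφ'cup, h20', -⟩ := hP (N x₁P) hx'1 hx'2 hx'3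
  have hp'0 : p' ≠ 0 := generator_ne_zero hS' hp'gen
  -- `ρ = R ∘ M` and `ψ = φ⁻¹ ∘ ρ ∘ φ'`
  set ρ : Module.End ℂ (K3Index → ℂ) := twistR * M with hρdef
  have hρ2 : ∀ a b, k3Form (ρ a) (ρ b) = 2 * k3Form a b := fun a b => by
    rw [hρdef, Module.End.mul_apply, Module.End.mul_apply, k3Form_twistR, hM2]
  have hper : ρ (N x₁P) = (2 : ℂ) • x₁P := by rw [hρdef, Module.End.mul_apply, hMN', twistR_x₁P]
  have hper' : ρ (star (N x₁P)) = (2 : ℂ)⁻¹ • star x₁P := by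
    rw [hρdef, Module.End.mul_apply, ← ratEnd_star N hNrat, hMN', twistR_star_x₁P]
  set ψ : complexBetti S' (2 * 1) →ₗ[ℂ] complexBetti S (2 * 1) :=
    φ.symm.toLinearMap ∘ₗ ρ ∘ₗ φ'.toLinearMap with hψ
  have hψapply : ∀ y, ψ y = φ.symm (ρ (φ' y)) := fun y => rfl
  have htype : ∀ (i j : ℕ) y, IsOfHodgeType 2 S' (2 * 1) i j y →
      IsOfHodgeType 2 S (2 * 1) i j (ψ y) := by
    intro i j y hy
    rw [hψapply]
    exact isOfHodgeType_markingConj_of_star φ p x₁P φ' p' (N x₁P) ρ hHT hS hS' hφint hφcup h20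
      x₁P_pos hφ'int hφ'cup hp'0 h20' hx'2 hρ2 two_ne_zero (inv_ne_zero two_ne_zero) hper hper'
      i j y hy
  have hsim : ∀ (x y : complexBetti S' (2 * 1)) (a : ℂ),
      cupProduct (rfl : 2 * 1 + 2 * 1 = 2 * 2) x y = a • p' →
        cupProduct (rfl : 2 * 1 + 2 * 1 = 2 * 2) (ψ x) (ψ y) = ((2 : ℂ) * a) • p := by
    intro x y a hxy
    rw [hψapply, hψapply]
    exact cupProduct_markingConj φ p φ' p' ρ hp'0 hφcup hφ'cup hρ2 x y a hxy
  -- apply the mutilated crux at the rationally normalised orientation family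
  obtain ⟨γ, hγ, hψγ⟩ := h ratFamily (OrientationFamily.hasPoincareDuality _) S S' hS hS' p p'
    ⟨hpint, hpgen⟩ ⟨hp'int, hp'gen⟩ ψ htype hsim
  have hSS' : IsSmoothProjective (2 + 2) (S ⊗ S') := IsSmoothProjective.tensor_holds hS.1 hS'.1
  -- `γ` is a complex combination of RATIONAL algebraic classes
  have hγspan : γ ∈ Submodule.span ℂ {c : complexBetti (S ⊗ S') (2 * 2) |
      IsRationalClass c ∧ c ∈ algebraicClasses (S ⊗ S') 2} :=
    hspan.supportedClasses_le_span hSS' (2 * 2) 2 hγ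
  obtain ⟨n, f, g, hsum⟩ := Submodule.mem_span_set'.1 hγspan
  -- the actions of the rational pieces
  let θ : Fin n → (complexBetti S' (2 * 1) →ₗ[ℂ] complexBetti S (2 * 1)) := fun i =>
    (complexGysin ratFamily hSS' hS.1 (SemiCartesianMonoidalCategory.fst S S')
        (rfl : 2 * 1 + 2 * 2 + 2 * 2 = 2 * 1 + 2 * (2 + 2))) ∘ₗ
      ((cupProduct (rfl : 2 * 1 + 2 * 2 = 2 * 1 + 2 * 2)).flip
          (g i : complexBetti (S ⊗ S') (2 * 2))) ∘ₗ
      (complexBetti.map (SemiCartesianMonoidalCategory.snd S S') (2 * 1)).hom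
  have hθ : ∀ i y, θ i y = complexGysin ratFamily hSS' hS.1 (SemiCartesianMonoidalCategory.fst S S')
      (rfl : 2 * 1 + 2 * 2 + 2 * 2 = 2 * 1 + 2 * (2 + 2))
      (cupProduct (rfl : 2 * 1 + 2 * 2 = 2 * 1 + 2 * 2)
        (complexBetti.map (SemiCartesianMonoidalCategory.snd S S') (2 * 1) y) (g i)) :=
    fun i y => rfl
  have hψsum : ∀ y, ψ y = ∑ i, f i • θ i y := by
    intro y
    rw [hψγ y, ← hsum, map_sum, map_sum]
    refine Finset.sum_congr rfl fun i _ => ?_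
    rw [map_smul, map_smul, hθ]
  -- a Hodge model of `S × S′`
  obtain ⟨A⟩ := (hM (2 + 2) (S ⊗ S')).nonempty hSS'
  -- each `σᵢ = φ ∘ θᵢ ∘ φ′⁻¹` is defined over `ℚ` (Gysin along `ratFamily`, cup, pull-back preserve rationality)
  have hσrat : ∀ i (v : K3Index → ℤ), ∃ w : K3Index → ℚ,
      (φ.toLinearMap ∘ₗ θ i ∘ₗ φ'.symm.toLinearMap) (fun j => (v j : ℂ)) = fun j => (w j : ℂ) := by
    intro i v
    have hint : IsIntegralClass (φ'.symm fun j => (v j : ℂ)) :=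
      (hφ'int _).2 ⟨v, LinearEquiv.apply_symm_apply _ _⟩
    have hrat : IsRationalClass (θ i (φ'.symm fun j => (v j : ℂ))) := by
      rw [hθ]
      exact isRationalClass_complexGysin_ratFamily hSS' hS.1 _ _
        ((hint.isRationalClass.map _).cup rfl (g i).2.1)
    obtain ⟨w, hw⟩ := (isRationalClass_iff_of_marking hS φ hφint _).1 hrat
    exact ⟨w, hw⟩
  -- … and carries the twin period `N x₁` into the period line `ℂ x₁` (type calculus of `[γᵢ]_*`)
  have hσper : ∀ i, ∃ tᵢ : ℂ,
      (φ.toLinearMap ∘ₗ θ i ∘ₗ φ'.symm.toLinearMap) (N x₁P) = tᵢ • x₁P := by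
    intro i
    have hγT : IsOfHodgeType (2 + 2) (S ⊗ S') (2 * 2) 2 2 (g i : complexBetti (S ⊗ S') (2 * 2)) := by
      have hc : A.pullback (2 * 2) (g i : complexBetti (S ⊗ S') (2 * 2)) ∈ A.hodgeConiveau (2 * 2) 2 :=
        hG hSS' A (2 * 2) 2 ⟨g i, (g i).2.2, rfl⟩
      have hle : A.hodgeConiveau (2 * 2) 2 ≤ A.hodgePQ (2 * 2) 2 2 := by
        refine iSup_le fun p₁ => iSup_le fun q₁ => iSup_le fun hpq => iSup_le fun hp₁ =>
          iSup_le fun hq₁ => ?_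
        obtain ⟨rfl, rfl⟩ : p₁ = 2 ∧ q₁ = 2 := by omega
        exact le_rfl
      exact ⟨A, hle hc⟩
    have hsndT : IsOfHodgeType (2 + 2) (S ⊗ S') (2 * 1) 2 0
        (complexBetti.map (SemiCartesianMonoidalCategory.snd S S') (2 * 1) (φ'.symm (N x₁P))) :=
      IsOfHodgeType.map_of_independent hI h20' hSS' hS'.1 A (SemiCartesianMonoidalCategory.snd S S')
    have hcupT := cupPreservesHodgeType_of_nonempty_hodgeModel hI (hM (2 + 2) (S ⊗ S')) hdR hSS'
      (rfl : 2 * 1 + 2 * 2 = 2 * 1 + 2 * 2) hsndT hγT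
    have hgysT : IsOfHodgeType 2 S (2 * 1) 2 0 (θ i (φ'.symm (N x₁P))) := by
      rw [hθ]
      exact isOfHodgeType_complexGysin hI hM hdR ratFamily hSS' hS.1
        (SemiCartesianMonoidalCategory.fst S S')
        (rfl : 2 * 1 + 2 * 2 + 2 * 2 = 2 * 1 + 2 * (2 + 2)) (by norm_num) (by norm_num) hcupT
    obtain ⟨tᵢ, ht⟩ := h20span _ hgysT
    refine ⟨tᵢ, ?_⟩
    simp only [LinearMap.coe_comp, LinearEquiv.coe_coe, Function.comp_apply]
    rw [ht, map_smul, LinearEquiv.apply_symm_apply]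
  -- KEY LEMMA: hence `σᵢ (N a) ∈ ℂ a` for `a = e₁ + f₁`
  have hσa : ∀ i, ∃ tᵢ : ℂ,
      φ (θ i (φ'.symm (N fun j => (aV j : ℂ)))) = tᵢ • fun j => (aV j : ℂ) := by
    intro i
    obtain ⟨tᵢ, ht⟩ := hσper i
    refine ⟨tᵢ, ?_⟩
    have key := ratEnd_aV_of_eigen ((φ.toLinearMap ∘ₗ θ i ∘ₗ φ'.symm.toLinearMap) * N)
      (ratEnd_mul _ N (hσrat i) hNrat) (lam := tᵢ) (by rw [Module.End.mul_apply, ht])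
    rw [Module.End.mul_apply] at key
    exact key
  -- summing up: `R a = φ (ψ (φ′⁻¹ (N a))) ∈ ℂ a`, but its `e₂`-coordinate is `¾(√2+1) i ≠ 0`
  choose t ht using hσa
  have hRa : twistR (fun j => (aV j : ℂ)) = (∑ i, f i * t i) • fun j => (aV j : ℂ) := by
    have e1 : φ (ψ (φ'.symm (N fun j => (aV j : ℂ)))) = twistR (fun j => (aV j : ℂ)) := by
      rw [hψapply, LinearEquiv.apply_symm_apply, LinearEquiv.apply_symm_apply, hρdef,
        Module.End.mul_apply, hMN']
    rw [← e1, hψsum, map_sum, Finset.sum_smul]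
    refine Finset.sum_congr rfl fun i _ => ?_
    rw [map_smul, ht i, smul_smul]
  have he := congrFun hRa (Sum.inr (Sum.inr (Sum.inl 0)))
  simp only [Pi.smul_apply, smul_eq_mul] at he
  refine twistR_aV_e₂_ne_zero ?_
  rw [he]
  simp


/-! ## §4 Non-vacuity of X modulo the K3 facts -/

/-- **X's hypotheses are inhabited (modulo the period fact and the Hodge-type fact), by an injective
`ψ` between two projective K3 surfaces.** Take the explicit rational lattice `2`-similitude `M` with
rational inverse `N` (`exists_twoSimilitude_k3Lattice`), the marked projective K3 surface `(S, φ, p)`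
with period `x₀ = (e₁+f₁) + i(e₂+f₂)` and the marked projective K3 surface `(S′, φ′, p′)` with the
TWIN period `N x₀` (a projective period point, `periodPt_twin`; both from
`Huybrechts_K3_periodSurjective_projective`). Then `ψ = φ⁻¹ ∘ M ∘ φ′ : H²(S′(ℂ);ℂ) → H²(S(ℂ);ℂ)` is
rational (`isRationalClass_markingConj`), preserves every Hodge type (`isOfHodgeType_markingConj`,
since `M N x₀ = x₀`; needs `Huybrechts_K3_hodgeTypes_H2`), doubles cup products for the generators
`p, p′` (`cupProduct_markingConj`), and is injective (`N M = 1`). So X is not vacuous for the right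
reason: a proof must produce an algebraic class on `S × S′` inducing THIS `ψ` — exactly the twin
transport the route proposes. (The sibling's Transfer file uses the same construction inside
`twinSimilitudeAlgebraic_of_twinTransport`; here it is isolated as the non-vacuity certificate of X.)
[cite: Huybrechts2016K3, Ch. 6 Rem. 3.3 and Ch. 7 (surjectivity of the period map)]
[cite: Buskin2019, §6.2] -/
theorem hypotheses_inhabited (hP : Huybrechts_K3_periodSurjective_projective)
    (hHT : Huybrechts_K3_hodgeTypes_H2) :
    ∃ (S S' : SchemeOver ℂ) (_ : IsK3Surface S) (_ : IsK3Surface S')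
      (p : complexBetti S (2 * 2)) (p' : complexBetti S' (2 * 2))
      (ψ : complexBetti S' (2 * 1) →ₗ[ℂ] complexBetti S (2 * 1)),
      (IsIntegralClass p ∧ ∀ q : complexBetti S (2 * 2), IsIntegralClass q → ∃ n : ℤ, q = n • p) ∧
      (IsIntegralClass p' ∧ ∀ q : complexBetti S' (2 * 2), IsIntegralClass q → ∃ n : ℤ, q = n • p') ∧
      (∀ x, IsRationalClass x → IsRationalClass (ψ x)) ∧
      (∀ (i j : ℕ) x, IsOfHodgeType 2 S' (2 * 1) i j x → IsOfHodgeType 2 S (2 * 1) i j (ψ x)) ∧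
      (∀ (x y : complexBetti S' (2 * 1)) (a : ℂ),
          cupProduct (rfl : 2 * 1 + 2 * 1 = 2 * 2) x y = a • p' →
            cupProduct (rfl : 2 * 1 + 2 * 1 = 2 * 2) (ψ x) (ψ y) = ((2 : ℂ) * a) • p) ∧
      Function.Injective ψ := by
  obtain ⟨M, N, hMrat, hNrat, hMN, hNM, hM2⟩ := exists_twoSimilitude_k3Lattice
  have hMN' : ∀ a, M (N a) = a := fun a => by
    rw [← Module.End.mul_apply, hMN, Module.End.one_apply]
  have hNM' : ∀ a, N (M a) = a := fun a => by
    rw [← Module.End.mul_apply, hNM, Module.End.one_apply]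
  have hN2 : ∀ a b, k3Form (N a) (N b) = (2 : ℂ)⁻¹ * k3Form a b := by
    intro a b
    have h := hM2 (N a) (N b)
    rw [hMN', hMN'] at h
    rw [h, ← mul_assoc, inv_mul_cancel₀ (two_ne_zero' ℂ), one_mul]
  -- the twin period `N x₀` is a projective period point
  obtain ⟨hx'1, hx'2, hx'3⟩ :=
    periodPt_twin N hNrat hN2 (x := x₀P) ⟨x₀P_sq, x₀P_pos, uV, uV_x₀P, uV_sq⟩
  -- the two marked projective K3 surfaces
  obtain ⟨S, hS, φ, p, hpint, hpgen, hφint, hφcup, h20, -⟩ :=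
    hP x₀P x₀P_sq x₀P_pos ⟨uV, uV_x₀P, uV_sq⟩
  obtain ⟨S', hS', φ', p', hp'int, hp'gen, hφ'int, hφ'cup, h20', -⟩ := hP (N x₀P) hx'1 hx'2 hx'3
  have hp'0 : p' ≠ 0 := generator_ne_zero hS' hp'gen
  have hper : ∃ t : ℂ, M (N x₀P) = t • x₀P := ⟨1, by rw [hMN', one_smul]⟩
  refine ⟨S, S', hS, hS', p, p', φ.symm.toLinearMap ∘ₗ M ∘ₗ φ'.toLinearMap, ⟨hpint, hpgen⟩,
    ⟨hp'int, hp'gen⟩, ?_, ?_, ?_, ?_⟩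
  · exact fun y hy => isRationalClass_markingConj φ φ' M hS hS' hφint hφ'int hMrat hy
  · exact isOfHodgeType_markingConj φ p x₀P φ' p' (N x₀P) M hHT hS hS' hφint hφcup h20 x₀P_pos
      hφ'int hφ'cup hp'0 h20' hx'2 hMrat two_ne_zero hM2 hper
  · exact fun y z a h => cupProduct_markingConj φ p φ' p' M hp'0 hφcup hφ'cup hM2 y z a h
  · intro y z hyz
    have h1 : M (φ' y) = M (φ' z) := φ.symm.injective hyz
    have h2 : φ' y = φ' z := by
      have := congrArg N h1
      rwa [hNM', hNM'] at this
    exact φ'.injective h2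

/-! ## §5 Load-bearing table, junk audit, strengthenings, why X resists, next regimes

All statements below are ON PAPER unless a Lean name is given.

### Load-bearing table (drop one hypothesis of X at a time)

* `htype` dropped — FALSE: §3 (`twinSimilitudeAlgebraic_false_without_htype`, Lean, modulo 5 named
  facts). Any proof must use type preservation.
* `hrat` dropped — FALSE: §3b (`twinSimilitudeAlgebraic_false_without_hrat`, Lean, modulo 7 named
  facts). Any proof must use rationality of `ψ`. CAVEAT for future witnesses: at CM periods (e.g.
  the `x₀` of §3, rank `T = 2`, `E = ℚ(i)`) the `R`-twist IS a `ℂ`-combination of rational Hodge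
  `2`-similitudes (`R|_T ∈ E ⊗ ℂ`), hence `ℂ`-algebraic GIVEN X (`induced_add`/`induced_smul`); the
  refutation needs `End_Hdg(T) = ℚ`, obtained here cheaply from ODD rank `T = 3` and `√2 ∉ ℚ`.
* `hsim` dropped ("every rational type-preserving `ψ : H²(S′) → H²(S)` is algebraic") — NOT
  load-bearing for TRUTH: it is HC for `S × S′` in the Künneth component `H² ⊗ H²`, implied by HC
  exactly like X. It is load-bearing for the ROUTE only (Buskin-type transport needs an isometry /
  similitude to build the hyperholomorphic carrier). Information for provers: no proof step may
  derive a contradiction from `hsim`'s failure; `hsim` can only be used constructively (to factor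
  `ψ = Ψ ∘ (Ψ⁻¹ψ)` with `Ψ⁻¹ψ` an isometry, as in `twinSimilitudeAlgebraic_of_anchor`).
* K3 hypotheses (`H¹(𝒪) = 0`, nowhere-vanishing holomorphic 2-form) dropped, keeping smooth
  projective surfaces — NOT load-bearing for truth (still HC for a product of surfaces, open in
  general: e.g. surfaces with `p_g > 0`), load-bearing for the route (period map, Torelli, Buskin).
* projectivity dropped (compact Kähler K3s) — cannot be expressed in the tree (`IsSmoothProjective`
  bundles smooth + projective + geometrically irreducible); on paper FALSE for non-projective K3s is
  NOT known either (Buskin's theorem holds for all Kähler K3s with "algebraic" read as analytic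
  cycle classes ⊗ ℚ… but `algebraicClasses` is Zariski-coniveau, meaningless there). Not a regime
  of X.
* `μ.HasPoincareDuality` dropped — irrelevant: `OrientationFamily.hasPoincareDuality` is a theorem of
  the tree (every orientation family has PD), and different `μ` change `complexGysin` by units
  (`complexGysin_eq_smul_of_orientationFamily`), absorbed into `γ` (`algebraicClasses` is a
  `ℂ`-submodule). The `∀ μ` is decoration-equivalent to `∃ μ`.
* generator clauses for `p, p′` weakened to "`p, p′ ≠ 0`" — then `hsim` with an irrational ratio
  `p/p_int` makes the hypothesis set EMPTY or rescales the multiplier: X[p := c·p₀] is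
  `SimAlgAt[2/c]`-like; for `c ∉ ℚ` no rational `ψ` satisfies it (marking argument as in §2), for
  `c ∈ ℚ_{>0}` it is the sibling crux at multiplier `2/c`. So the integrality clauses exactly pin
  the multiplier; they are not removable but carry no hidden strength.

### Junk audit (interface-typed statement; step 6 of the refuter protocol)

* Empty scheme: excluded — `IsSmoothProjective 2 S` contains `GeometricallyIrreducible S.hom`
  (irreducible ⇒ nonempty). (Were it admitted, X would hold trivially there: all cohomology
  vanishes, `γ = 0`.)
* Junk topologies on `S(ℂ)`: impossible — `ComplexPoints` carries the constructed analytic topology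
  (`AlgPoints.instTopologicalSpace`), and a `HodgeModel` requires `IsAnalytification` (a
  homeomorphism from a σ-compact complex 2-manifold).
* Junk Hodge models: `IsOfHodgeType` is `∃` over models; an exotic model could only ENLARGE Hodge
  types, which weakens `htype` (more `ψ` qualify) AND weakens the `(2,0)`-line conclusion used in
  §3 — but models are unique up to biholomorphism over `S(ℂ)` (`IsAnalytification.unique`) and the
  comparison families differ by scalars (`hodgePQ_independent_of_hodgeModel`, named fact). No junk.
* `algebraicClasses = N²H⁴` with `ℂ`-coefficients: the conclusion asks for `γ` in the `ℂ`-SPAN of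
  cycle classes, not a rational/integral combination. For rational `ψ` this is equivalent on paper
  (`(V_ℚ ⊗ ℂ) ∩ Hom_ℚ = V_ℚ`); it is WEAKER than "γ rational", so no refutation can come from
  irrationality of `γ`.
* Cup-product order / projection convention in `fst_*(snd^* x ∪ γ)`: even degrees, and the transpose
  of an algebraic class is algebraic; the same expression is used verbatim by Buskin's named fact and
  the landed glue, so a convention slip would surface there first (kill criterion (iv) of the route:
  restate, never close).

### Natural strengthenings (none refutable in the tree without a K3; paper status)

* `∃! γ`: FALSE whenever the hypotheses are inhabited — `γ + fst^*[pt]` (`[pt] ∈ N²H⁴(S)`,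
  `fst^*[pt] = [pt × S′]` algebraic) acts identically on `H²` (the Künneth component `H⁴ ⊗ H⁰`
  acts as zero on `H² → H²`).
* `γ` INTEGRAL combination of cycle classes: false in general for rational non-integral `ψ`
  (integral correspondences act integrally); for the integral twin `M = AA` itself it is the
  INTEGRAL Hodge conjecture flavour on `S × S′` — unknown, not claimed by the route (`m·graph`,
  `m = 2`).
* `γ` EFFECTIVE (a subvariety, not a combination): FALSE off the Nikulin locus — a prime cycle of
  degree 1 over `S` inducing a `2`-similitude would be the graph of a degree-2 rational map
  `S ⇢ S′`, forcing a Nikulin involution (route text; Zucker barrier used positively).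
* all multipliers `r` (= `HodgeSimilitudeAlgebraic`): open, sibling crux; `r = 1` is Buskin.

### Why X resists (for the planners) — and the barrier catalogue

X is HC for `K3 × K3` in the similitude sector. Known cases: `r = 1` (Buskin 2019 / Huybrechts
2019), CM pairs (Huybrechts 2019), the Nikulin locus `T_ℚ ↪ U³_ℚ ⊕ E₈(−2)_ℚ`, `dim T ≤ 13`
(Varesco 2023 Thm 2.1 / Prop 2.5), and everything under the Kuga–Satake Hodge conjecture
(Varesco 2023 Thm 0.3). Unknown: the 8-dimensional RM-by-`√2` families (van Geemen–Schütt 2023).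
A disproof = a non-algebraic RATIONAL Hodge class on a PROJECTIVE fourfold `S × S′`; the catalogued
obstructions to algebraicity do not bite: `IntegralCoefficients` (Atiyah–Hirzebruch, Kollár: torsion
/ non-divisible INTEGRAL classes — invisible in `ℂ`-coefficients), `KaehlerCounterexamples`,
`KaehlerCoherentSheaves` (Zucker, Voisin: NON-projective tori; moreover NARROWED in the tree —
Markman's secant sheaves prove the Weil classes they were thought to obstruct),
`GeneralizedHodgeTrivialReasons` (Grothendieck: about GHC and coniveau ≥ 1, not about `(p,p)`
classes), `ConjugateVarieties`/`AbsoluteHodgeClasses` (Serre: conjugation changes topology — no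
statement about algebraicity of a given Hodge class), `SingularVarieties`, `NormalFunctions`,
`GriffithsGroupInfiniteRank`, `DecompositionOfTheDiagonal` (Chow-theoretic, not cohomological
obstructions). The one catalogue entry that ENGAGES X is a TECHNIQUE barrier on the proof side:
`Literature.Barriers.HodgeConjecture.Weil1977_exceptionalHodgeClasses` /
`Mumford1968_simpleFourfold_exceptionalHodgeClasses` (technique_class divisor-classes,
lefschetz-one-one, cup-product): X's target classes are EXCEPTIONAL on `S × S′` — the divisor ring
`D²(S × S′) = NS ⊗ NS′ ⊕ ℚ[S×pt] ⊕ ℚ[pt×S′]` (K3s have `H¹ = 0`) meets `T ⊗ T′` in `0`, while the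
Künneth class of a `2`-similitude has non-zero `T ⊗ T′`-component — so no argument by Lefschetz
`(1,1)` + intersections of divisors can prove X; the route's evasion (Chern classes of
hyperholomorphic / twisted sheaves, Buskin–Markman) is the known one (`evasions_known` of the
narrowed Kähler barrier: Markman 2023/2025). In the tree: no `IsK3Surface` instance is constructible
(needs an analytification with Hodge decomposition), so no junk-instance refutation either; every
negative statement about X is necessarily MODULO the K3 existence facts (§3, §4).

### Next regimes (for a re-arm / cycle 2)

1. (DONE in v2: the `hrat` row is certified, §3b.) Remaining hypothesis rows are not refutable
   (`hsim`, K3-ness: HC-implied) or decoration (`μ`, generator signs).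
2. If a skeleton for X is registered (targets non-empty): attack its stubs first — in particular
   any stub asserting composition/transposition of algebraic correspondences on the REAL carriers
   (`hcomp` of the Transfer file) deserves a junk audit of the `complexGysin` degree bookkeeping.
3. `lit` watch (searchd rc 75 throughout this cycle): new results on Hodge similarities /
   isogenies of K3 surfaces with real multiplication (Varesco; van Geemen–Schütt; Huybrechts;
   Markman's secant-sheaf programme via Kuga–Satake) — a theorem proving X closes the item as
   known; a counterexample to HC in this sector kills it.
-/

end Summit.HodgeConjecture.HodgeConjecture.Cruxes.TwinSimilitudeAlgebraic.Disproof

end
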